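import Literature.NumberTheory.Automorphic.ArchEndoscopicChartSplitConeLimit      -- ★ docking kit: (DOCK-w₀) `chartOrbHLoc_eq_of_chartTorusHLoc_eq`, `chartTorusHLoc_eq_torusU`, `endoBlockAt_eq_mk_hypBlockGL`, (T-CONGR) `chartOrbHLoc_eq_of_mem_iff`, `measure_pos_lt_top_of_subgroup_eq`, `isInvInvariant_of_comm`
import Literature.NumberTheory.Automorphic.ArchRankOneSplitOrbitContinuity        -- ★ (A0-b) `abs_sub_smul_integral_descConj_hypBlockGL_eq_smul_integral_prod`, `continuous_integral_prod_conj_hypBlockGL_half`; brings ★ Iwasawa `exists_measure_quotient_torusU_complex_two_eq_smul_map`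
import HarnessLib

/-!
# THE ONE-PLACE SPLIT-CURRENCY BRIDGE: `|eˣ − e⁻ˣ| · chartOrbHLoc L S w ν_w f (x, ·, θ) = D · ∫_{K × N} f(k · (t_{0,θ} h_{x∕2} n h_{x∕2}) · k⁻¹) d(κ ⊗ μ_N)`
# for a GIVEN Iwasawa datum `(K, κ, μ_N)` of `U(Φ₂)_w`, ONE `D > 0` for all labels `S ∋ w`, all `f`, all `x ≠ 0`
# (Harish-Chandra's `F_f^A` chart; Varadarajan 1989 §6.4 Lemma 21, Thm 23; Shelstad 1979 Lemma 4.3; Rogawski 1990 §8.2)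

Topic `NumberTheory/Rogawski1990`; namespace `Literature.NumberTheory.Rogawski1990`.  THEOREMS ONLY (no `def`, no instance, no notation, no axiom, no named fact,
no `sorry`).  Cell `pub/hodgecm-mathlib`, crux H413 (`stmt-HodgeConjecture-24833`), N8-INNER row (8e) «the rank-one fact `h_W`» (census `CENSUS-8e-hW.v1`, F0P3a-p02 (g23)),
piece **(N2) «`Λ_{f₀} ≡ 0` NEAR `0` FROM (G1-w)»**: the currency bridge between the local chart orbital functional ★ `chartOrbHLoc L S w ν_w f cw` at a SPLIT place `w ∈ S`
(chart point `hypBlockGL (cw 0) (cw 2) = diag(e^{x+iθ}, e^{−x+iθ})`, `x = cw 0 ≠ 0`, `θ = cw 2`) and the `K × N` HALF-CHART INTEGRAL of ★ (B-r1)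
`ArchRankOneJumpAllOrdersChart` (token `hΛ : Λ g x = ∫_{K×N} g(↑↑(k (t_{0,θ} h_{x∕2} n h_{x∕2}) k⁻¹)) d(κ ⊗ μ_N)`).  Author F0P3a-p09 (g10).  Count-neutral.

THE MATHEMATICS.  Fix a complex place `w`, a Haar measure `ν_w` on `U(Φ₂)_w`, and an Iwasawa datum: a compact `K ≤ U(Φ₂)_w` with `U(Φ₂)_w = K·B` and Haar measures `κ` on `K`,
`μ_N` on the unipotent radical `N`.  For every label `S ∋ w` the local chart orbital functional is `D₀ · ∫_{U(Φ₂)_w ⧸ T} f(y · hypBlockGL x θ · y⁻¹) d(ν_w ∕ t)` with ONE box mass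
`D₀ > 0` (★ (T-CONGR) + ★ (DOCK-w₀), `T = torusU` the diagonal torus, `t` any inversion-invariant Haar measure on it); the canonical quotient measure `ν_w ∕ t` is invariant, Radon and
non-zero, hence of Iwasawa form `C • ((k, n) ↦ knT)_*(κ ⊗ μ_N)` with `C ≠ 0` for the GIVEN datum (★ `exists_measure_quotient_torusU_complex_two_eq_smul_map`); and ★ (A0-b) reads
`|eˣ − e⁻ˣ| • ∫_{U ⧸ T} f(y · hypBlockGL x θ · y⁻¹) d(C • …) = C • ∫_{K × N} f(k · (t_{0,θ} h_{x∕2} n h_{x∕2}) · k⁻¹) d(κ ⊗ μ_N)` for `x ≠ 0`.  So `D = D₀ · C`.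

WHAT IS PROVED (all at a place `w`, in the `archLocal L 2 Φ₂ w` spelling of ★ `chartOrbHLoc`; the unipotent radical `N` and the Borel subgroup `B` enter AS VARIABLES
`N B : Subgroup U(Φ₂)_w` bound by `hN : N = unipotentU conj (σ_w Φ₂)`, `hB : B = borelU conj (σ_w Φ₂)` — ★ (DOCK-w₀)'s «subgroup as a variable; `subst`» idiom, since `U(Φ₂)_w` IS
`U(conj, σ_w Φ₂)(ℂ)` by definition but not reducibly so; a consumer holding ★ (B-r1)'s datum in the `unitaryGroupOfForm` spelling passes `hN := rfl`, `hB := rfl` and his own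
measures, and the NAMED instance binders `iκ iμN` explicitly if instance search does not see through the spelling):
* §1 **`exists_absExpSub_mul_chartOrbHLoc_eq_mul_integral_halfChart`** — `∃ D > 0, ∀ f` continuous, `∀ S ∋ w, ∀ cw, cw 0 ≠ 0 →`
  `↑|e^{cw 0} − e^{−cw 0}| * chartOrbHLoc L S w ν_w f cw = ↑D * ∫_{K × N} f(k · (t_{0, cw 2} · h_{cw 0∕2} · n · h_{cw 0∕2}) · k⁻¹) d(κ ⊗ μ_N)`.
* §2 `integral_halfChart_eq_zero_of_chartOrbHLoc_eq_zero` — pointwise transfer of vanishing off the wall.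
* §3 **`halfChart_eq_zero_and_iteratedDeriv_eq_zero_of_chartOrbHLoc_eq_zero`** — if the split readings of a continuous compactly supported `f` vanish for `0 < |cw 0| < δ` at the
  centre `cw 2 = θ` (the (G1-w) clause of ★ `exists_compactType_wallGenerator`, read on the ray `cw = ![x, 0, θ]`), then the half-chart integral `Λ` (token `hΛ`) vanishes on
  `|x| < δ` — at `x = 0` by continuity ★ `continuous_integral_prod_conj_hypBlockGL_half` — and ALL its jets at `0` vanish: `∀ n, iteratedDeriv n Λ 0 = 0`.  With ★ (B-r1) this kills
  every jump `κ₀ iⁿ ∂ₓⁿΛ(0)` of the compact-type generator's elliptic reading (census §0 2(c)).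
HONEST LABEL: HC_CM is proved only modulo the 7 printed citations (2 remaining: hLiu418 = `stmt-HodgeConjecture-24832`, h413 = `stmt-HodgeConjecture-24833`) until rung 0 closes;
rank-one measure-theoretic bookkeeping over the ★ kit, pays nothing by itself.

## References
* [Varadarajan1989] V. S. Varadarajan, *An Introduction to Harmonic Analysis on Semisimple Lie Groups*, Cambridge Stud. Adv. Math. 16 (1989), §6.4 Lemma 21, Thm 23.
* [Shelstad1979] D. Shelstad, *Characters and inner forms of a quasi-split group over ℝ*, Compositio Math. 39 (1979), Lemma 4.3 p. 25, §4 pp. 22–23.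
* [Rogawski1990] J. D. Rogawski, *Automorphic Representations of Unitary Groups in Three Variables*, Ann. of Math. Stud. 123 (1990), §3.6 p. 31, §8.2 pp. 119–122, §8.3 p. 124.
* [DeitmarEchterhoff2014] A. Deitmar, S. Echterhoff, *Principles of Harmonic Analysis*, 2nd ed. (2014), Thm. 1.5.3 (invariant quotient measures).
* [Folland1995] G. B. Folland, *A Course in Abstract Harmonic Analysis* (1995), §2.6 Thm. 2.49, (2.52).
-/

set_option autoImplicit false

noncomputable section

open MeasureTheory MeasureTheory.Measure Set Filter Topology NumberField NumberField.InfinitePlace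
open scoped ENNReal NNReal ComplexConjugate Real MatrixGroups Matrix

namespace Literature.NumberTheory.Rogawski1990

open Literature.NumberTheory.Automorphic Literature.NumberTheory.Automorphic.UnitaryGroup Literature.MeasureTheory.Group
open Literature.NumberTheory.Automorphic.UnitaryGroup.LineRing

section Docked

variable (L : Type) [Field L] [NumberField L] [IsCMField L] (w : {w : InfinitePlace L // IsComplex w})
  [MeasurableSpace ↥(archLocal L 2 (Matrix.of fun i j : Fin 2 => if i.val + j.val + 1 = 2 then (1 : L) else 0) w)]
  [BorelSpace ↥(archLocal L 2 (Matrix.of fun i j : Fin 2 => if i.val + j.val + 1 = 2 then (1 : L) else 0) w)]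
  (νw : Measure ↥(archLocal L 2 (Matrix.of fun i j : Fin 2 => if i.val + j.val + 1 = 2 then (1 : L) else 0) w)) [νw.IsHaarMeasure] [νw.IsMulRightInvariant]
  {K N B : Subgroup ↥(archLocal L 2 (Matrix.of fun i j : Fin 2 => if i.val + j.val + 1 = 2 then (1 : L) else 0) w)}
  (hN : N = unipotentU (starRingEnd ℂ) ((Matrix.of fun i j : Fin 2 => if i.val + j.val + 1 = 2 then (1 : L) else 0).map w.1.embedding))
  (hB : B = borelU (starRingEnd ℂ) ((Matrix.of fun i j : Fin 2 => if i.val + j.val + 1 = 2 then (1 : L) else 0).map w.1.embedding))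
  (κ : Measure ↥K) (μN : Measure ↥N)

/-! ## §1 The bridge: ONE constant `D > 0` for all labels `S ∋ w`, all continuous `f`, all `cw` with `cw 0 ≠ 0` -/

include hN hB in
/-- **THE ONE-PLACE SPLIT-CURRENCY BRIDGE.**  `w` a complex place, `ν_w` a Haar measure on `U(Φ₂)_w`, `(K, κ, μ_N)` an Iwasawa datum (`K` compact, `U(Φ₂)_w = K·B`, `κ`, `μ_N` Haar on `K`
and on the unipotent radical `N`; `N`, `B` as variables bound by `hN`, `hB`).  There is ONE `D > 0` such that for every continuous `f : U(Φ₂)_w → ℂ`, every label `S ∋ w` and every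
local coordinate `cw` with `cw 0 ≠ 0`:
`↑|e^{cw 0} − e^{−cw 0}| * chartOrbHLoc L S w ν_w f cw = ↑D * ∫_{K × N} f(k · (hypBlockGL 0 (cw 2) · hypBlockGL (cw 0∕2) 0 · n · hypBlockGL (cw 0∕2) 0) · k⁻¹) d(κ ⊗ μ_N)` — the
normalised split reading IS the `K × N` half-chart integral of ★ (B-r1) at centre `cw 2`, up to the fixed positive constant `D = D₀ · C` (box mass times Iwasawa constant).
[cite: Varadarajan1989, §6.4 Lemma 21, Thm 23] [cite: Shelstad1979, Lemma 4.3 p. 25] [cite: Rogawski1990, §8.2 pp. 119–122; §8.3 p. 124] [cite: DeitmarEchterhoff2014, Thm. 1.5.3] -/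
theorem exists_absExpSub_mul_chartOrbHLoc_eq_mul_integral_halfChart
    (hK : IsCompact (K : Set ↥(archLocal L 2 (Matrix.of fun i j : Fin 2 => if i.val + j.val + 1 = 2 then (1 : L) else 0) w)))
    (hKB : ∀ g : ↥(archLocal L 2 (Matrix.of fun i j : Fin 2 => if i.val + j.val + 1 = 2 then (1 : L) else 0) w), ∃ k ∈ K, ∃ b ∈ B, g = k * b)
    [iκ : IsHaarMeasure κ] [iμN : IsHaarMeasure μN] :
    ∃ D : ℝ, 0 < D ∧ ∀ f : ↥(archLocal L 2 (Matrix.of fun i j : Fin 2 => if i.val + j.val + 1 = 2 then (1 : L) else 0) w) → ℂ, Continuous f →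
      ∀ S : Finset {w : InfinitePlace L // IsComplex w}, w ∈ S → ∀ cw : Fin 3 → ℝ, cw 0 ≠ 0 →
        (((|Real.exp (cw 0) - Real.exp (-(cw 0))| : ℝ) : ℂ) * chartOrbHLoc L S w νw f cw) =
          (D : ℂ) * ∫ p : ↥K × ↥N,
            f ((p.1 : ↥(archLocal L 2 (Matrix.of fun i j : Fin 2 => if i.val + j.val + 1 = 2 then (1 : L) else 0) w)) *
              ((⟨hypBlockGL 0 (cw 2), hypBlockGL_mem_archLocal L w 0 (cw 2)⟩ : ↥(archLocal L 2 (Matrix.of fun i j : Fin 2 => if i.val + j.val + 1 = 2 then (1 : L) else 0) w)) *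
                (⟨hypBlockGL (cw 0 / 2) 0, hypBlockGL_mem_archLocal L w (cw 0 / 2) 0⟩ : ↥(archLocal L 2 (Matrix.of fun i j : Fin 2 => if i.val + j.val + 1 = 2 then (1 : L) else 0) w)) *
                (p.2 : ↥(archLocal L 2 (Matrix.of fun i j : Fin 2 => if i.val + j.val + 1 = 2 then (1 : L) else 0) w)) *
                (⟨hypBlockGL (cw 0 / 2) 0, hypBlockGL_mem_archLocal L w (cw 0 / 2) 0⟩ : ↥(archLocal L 2 (Matrix.of fun i j : Fin 2 => if i.val + j.val + 1 = 2 then (1 : L) else 0) w))) *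
              (p.1 : ↥(archLocal L 2 (Matrix.of fun i j : Fin 2 => if i.val + j.val + 1 = 2 then (1 : L) else 0) w))⁻¹) ∂(κ.prod μN) := by
  subst hN hB
  haveI : Fact (0 < 2 * π) := ⟨Real.two_pi_pos⟩
  haveI := locallyCompactSpace_archLocal_two L w
  haveI := secondCountableTopology_archLocal_two L w
  -- `U(Φ₂)_w` is BY DEFINITION `U(conj, σ_w Φ₂)(ℂ)` and `σ_w Φ₂ = Φ₂`; work in that spelling (★ (DOCK-w₀) recipe)
  have hJ : ((Matrix.of fun i j : Fin 2 => if i.val + j.val + 1 = 2 then (1 : L) else 0).map w.1.embedding) = (StdForm.antidiagonal 2).over ℂ := by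
    rw [Literature.NumberTheory.Rogawski1990.antidiagOne_map, StdForm.over_antidiagonal_eq]
  letI iG : MeasurableSpace ↥(unitaryGroupOfForm (starRingEnd ℂ) ((Matrix.of fun i j : Fin 2 => if i.val + j.val + 1 = 2 then (1 : L) else 0).map w.1.embedding)) := ‹MeasurableSpace ↥(archLocal L 2 (Matrix.of fun i j : Fin 2 => if i.val + j.val + 1 = 2 then (1 : L) else 0) w)›
  haveI : BorelSpace ↥(unitaryGroupOfForm (starRingEnd ℂ) ((Matrix.of fun i j : Fin 2 => if i.val + j.val + 1 = 2 then (1 : L) else 0).map w.1.embedding)) := ‹BorelSpace ↥(archLocal L 2 (Matrix.of fun i j : Fin 2 => if i.val + j.val + 1 = 2 then (1 : L) else 0) w)›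
  haveI : LocallyCompactSpace ↥(unitaryGroupOfForm (starRingEnd ℂ) ((Matrix.of fun i j : Fin 2 => if i.val + j.val + 1 = 2 then (1 : L) else 0).map w.1.embedding)) := locallyCompactSpace_unitaryGroupOfForm_complex _
  haveI : SecondCountableTopology ↥(unitaryGroupOfForm (starRingEnd ℂ) ((Matrix.of fun i j : Fin 2 => if i.val + j.val + 1 = 2 then (1 : L) else 0).map w.1.embedding)) := secondCountableTopology_unitaryGroupOfForm_complex _
  let νw' : Measure ↥(unitaryGroupOfForm (starRingEnd ℂ) ((Matrix.of fun i j : Fin 2 => if i.val + j.val + 1 = 2 then (1 : L) else 0).map w.1.embedding)) := νw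
  haveI : νw'.IsHaarMeasure := ‹νw.IsHaarMeasure›
  haveI : νw'.IsMulRightInvariant := ‹νw.IsMulRightInvariant›
  -- the diagonal torus `T = torusU`: closed, abelian, with an inversion-invariant Haar measure `t`
  have hTc : IsClosed ((torusU (starRingEnd ℂ) ((Matrix.of fun i j : Fin 2 => if i.val + j.val + 1 = 2 then (1 : L) else 0).map w.1.embedding) : Subgroup ↥(unitaryGroupOfForm (starRingEnd ℂ) ((Matrix.of fun i j : Fin 2 => if i.val + j.val + 1 = 2 then (1 : L) else 0).map w.1.embedding))) : Set ↥(unitaryGroupOfForm (starRingEnd ℂ) ((Matrix.of fun i j : Fin 2 => if i.val + j.val + 1 = 2 then (1 : L) else 0).map w.1.embedding))) := isClosed_torusU_two _ _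
  haveI : LocallyCompactSpace ↥(torusU (starRingEnd ℂ) ((Matrix.of fun i j : Fin 2 => if i.val + j.val + 1 = 2 then (1 : L) else 0).map w.1.embedding)) := hTc.isClosedEmbedding_subtypeVal.locallyCompactSpace
  haveI : SecondCountableTopology ↥(torusU (starRingEnd ℂ) ((Matrix.of fun i j : Fin 2 => if i.val + j.val + 1 = 2 then (1 : L) else 0).map w.1.embedding)) := TopologicalSpace.Subtype.secondCountableTopology _
  haveI : BorelSpace ↥(torusU (starRingEnd ℂ) ((Matrix.of fun i j : Fin 2 => if i.val + j.val + 1 = 2 then (1 : L) else 0).map w.1.embedding)) := Subtype.borelSpace _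
  set t : Measure ↥(torusU (starRingEnd ℂ) ((Matrix.of fun i j : Fin 2 => if i.val + j.val + 1 = 2 then (1 : L) else 0).map w.1.embedding)) := Measure.haar with ht
  haveI : t.IsInvInvariant :=
    Literature.MeasureTheory.Group.isInvInvariant_of_comm _ hTc (fun x hx y hy => LineRing.forall_mem_torusU_comm (starRingEnd ℂ) _ hy x hx) t
  -- the quotient `U(Φ₂)_w ⧸ T`, Borel, and the quotient measure `ν_w ∕ t`: invariant, Radon, non-zero
  letI iQ : MeasurableSpace (↥(unitaryGroupOfForm (starRingEnd ℂ) ((Matrix.of fun i j : Fin 2 => if i.val + j.val + 1 = 2 then (1 : L) else 0).map w.1.embedding)) ⧸ torusU (starRingEnd ℂ) ((Matrix.of fun i j : Fin 2 => if i.val + j.val + 1 = 2 then (1 : L) else 0).map w.1.embedding)) := borel _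
  haveI iQB : BorelSpace (↥(unitaryGroupOfForm (starRingEnd ℂ) ((Matrix.of fun i j : Fin 2 => if i.val + j.val + 1 = 2 then (1 : L) else 0).map w.1.embedding)) ⧸ torusU (starRingEnd ℂ) ((Matrix.of fun i j : Fin 2 => if i.val + j.val + 1 = 2 then (1 : L) else 0).map w.1.embedding)) := ⟨rfl⟩
  haveI : SMulInvariantMeasure ↥(unitaryGroupOfForm (starRingEnd ℂ) ((Matrix.of fun i j : Fin 2 => if i.val + j.val + 1 = 2 then (1 : L) else 0).map w.1.embedding)) (↥(unitaryGroupOfForm (starRingEnd ℂ) ((Matrix.of fun i j : Fin 2 => if i.val + j.val + 1 = 2 then (1 : L) else 0).map w.1.embedding)) ⧸ torusU (starRingEnd ℂ) ((Matrix.of fun i j : Fin 2 => if i.val + j.val + 1 = 2 then (1 : L) else 0).map w.1.embedding)) (quotientMeasure (torusU (starRingEnd ℂ) ((Matrix.of fun i j : Fin 2 => if i.val + j.val + 1 = 2 then (1 : L) else 0).map w.1.embedding)) t hTc νw') :=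
    smulInvariantMeasure_quotientMeasure (torusU (starRingEnd ℂ) ((Matrix.of fun i j : Fin 2 => if i.val + j.val + 1 = 2 then (1 : L) else 0).map w.1.embedding)) t hTc νw'
  have hμ : (quotientMeasure (torusU (starRingEnd ℂ) ((Matrix.of fun i j : Fin 2 => if i.val + j.val + 1 = 2 then (1 : L) else 0).map w.1.embedding)) t hTc νw') ≠ 0 := quotientMeasure_ne_zero (torusU (starRingEnd ℂ) ((Matrix.of fun i j : Fin 2 => if i.val + j.val + 1 = 2 then (1 : L) else 0).map w.1.embedding)) t hTc νw'
  haveI hreg : (quotientMeasure (torusU (starRingEnd ℂ) ((Matrix.of fun i j : Fin 2 => if i.val + j.val + 1 = 2 then (1 : L) else 0).map w.1.embedding)) t hTc νw').Regular := regular_quotientMeasure (torusU (starRingEnd ℂ) ((Matrix.of fun i j : Fin 2 => if i.val + j.val + 1 = 2 then (1 : L) else 0).map w.1.embedding)) t hTc νw'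
  haveI : IsFiniteMeasureOnCompacts (quotientMeasure (torusU (starRingEnd ℂ) ((Matrix.of fun i j : Fin 2 => if i.val + j.val + 1 = 2 then (1 : L) else 0).map w.1.embedding)) t hTc νw') := hreg.toIsFiniteMeasureOnCompacts
  -- the Iwasawa datum in the `unitaryGroupOfForm` spelling, and the Iwasawa form of `ν_w ∕ t` w.r.t. it (★ `exists_measure_quotient_torusU_complex_two_eq_smul_map`)
  let K' : Subgroup ↥(unitaryGroupOfForm (starRingEnd ℂ) ((Matrix.of fun i j : Fin 2 => if i.val + j.val + 1 = 2 then (1 : L) else 0).map w.1.embedding)) := K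
  let κ' : Measure ↥K' := κ
  haveI : IsHaarMeasure κ' := iκ
  let μN' : Measure ↥(unipotentU (starRingEnd ℂ) ((Matrix.of fun i j : Fin 2 => if i.val + j.val + 1 = 2 then (1 : L) else 0).map w.1.embedding)) := μN
  haveI : IsHaarMeasure μN' := iμN
  have hK' : IsCompact (K' : Set ↥(unitaryGroupOfForm (starRingEnd ℂ) ((Matrix.of fun i j : Fin 2 => if i.val + j.val + 1 = 2 then (1 : L) else 0).map w.1.embedding))) := hK
  haveI : CompactSpace ↥K' := isCompact_iff_compactSpace.1 hK'
  have hKB' : ∀ g : ↥(unitaryGroupOfForm (starRingEnd ℂ) ((Matrix.of fun i j : Fin 2 => if i.val + j.val + 1 = 2 then (1 : L) else 0).map w.1.embedding)), ∃ k ∈ K', ∃ b ∈ borelU (starRingEnd ℂ) ((Matrix.of fun i j : Fin 2 => if i.val + j.val + 1 = 2 then (1 : L) else 0).map w.1.embedding), g = k * b := hKB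
  obtain ⟨C, hC0, hμC⟩ := exists_measure_quotient_torusU_complex_two_eq_smul_map hJ hK' hKB' κ' t μN'
    (quotientMeasure (torusU (starRingEnd ℂ) ((Matrix.of fun i j : Fin 2 => if i.val + j.val + 1 = 2 then (1 : L) else 0).map w.1.embedding)) t hTc νw') hμ
  have hCpos : (0 : ℝ) < (C : ℝ) := NNReal.coe_pos.2 (pos_iff_ne_zero.2 hC0)
  -- the box of the reference label `{w}` read inside `torusU` has positive finite `t`-mass `D₀`
  have hw1 : w ∈ ({w} : Finset {w : InfinitePlace L // IsComplex w}) := Finset.mem_singleton_self w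
  let TAL : Subgroup ↥(archLocal L 2 (Matrix.of fun i j : Fin 2 => if i.val + j.val + 1 = 2 then (1 : L) else 0) w) := torusU (starRingEnd ℂ) ((Matrix.of fun i j : Fin 2 => if i.val + j.val + 1 = 2 then (1 : L) else 0).map w.1.embedding)
  let tAL : Measure ↥TAL := t
  haveI : tAL.IsHaarMeasure := (inferInstance : t.IsHaarMeasure)
  haveI : tAL.IsInvInvariant := ‹t.IsInvInvariant›
  letI iQ' : MeasurableSpace (↥(archLocal L 2 (Matrix.of fun i j : Fin 2 => if i.val + j.val + 1 = 2 then (1 : L) else 0) w) ⧸ TAL) := iQ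
  haveI : BorelSpace (↥(archLocal L 2 (Matrix.of fun i j : Fin 2 => if i.val + j.val + 1 = 2 then (1 : L) else 0) w) ⧸ TAL) := iQB
  obtain ⟨hBpos, hBfin⟩ := measure_pos_lt_top_of_subgroup_eq (T' := TAL) (chartTorusHLoc_eq_torusU L {w} hw1) (chartBoxImgLoc L {w} w)
    (isCompact_chartBoxImgLoc L {w} w) (nonempty_interior_chartBoxImgLoc L {w} w) tAL
  set D₀ : ℝ := (tAL {m : ↥TAL | (m : ↥(archLocal L 2 (Matrix.of fun i j : Fin 2 => if i.val + j.val + 1 = 2 then (1 : L) else 0) w)) ∈ ((↑) : ↥(chartTorusHLoc L {w} w) → ↥(archLocal L 2 (Matrix.of fun i j : Fin 2 => if i.val + j.val + 1 = 2 then (1 : L) else 0) w)) '' chartBoxImgLoc L {w} w}).toReal with hD₀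
  have hD : 0 < D₀ := ENNReal.toReal_pos hBpos.ne' hBfin.ne
  refine ⟨D₀ * C, mul_pos hD hCpos, fun f hf S hw cw hcw => ?_⟩
  -- ★ (T-CONGR): the label enters only through `w ∈ S`; reduce to the reference label `{w}`
  rw [chartOrbHLoc_eq_of_mem_iff L w νw (S := S) (S' := {w}) (by rw [Finset.mem_singleton]; exact ⟨fun _ => rfl, fun _ => hw⟩) _ cw]
  -- ★ (DOCK-w₀): read `chartOrbHLoc L {w} w` through `torusU`, the chart point being `hypBlockGL (cw 0) (cw 2)`
  rw [chartOrbHLoc_eq_of_chartTorusHLoc_eq L {w} w νw (T := TAL) (chartTorusHLoc_eq_torusU L {w} hw1) hTc (iT := iQ') tAL _ cw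
    (LineRing.forall_mem_torusU_comm (starRingEnd ℂ) _ ((chartTorusHLoc_eq_torusU L {w} hw1) ▸ endoBlockAt_mem_chartTorusHLoc L {w} w cw))]
  have hfun : descConj (endoBlockAt L {w} w cw) TAL
        (LineRing.forall_mem_torusU_comm (starRingEnd ℂ) _ ((chartTorusHLoc_eq_torusU L {w} hw1) ▸ endoBlockAt_mem_chartTorusHLoc L {w} w cw)) f =
      descConj (⟨hypBlockGL (cw 0) (cw 2), hypBlockGL_mem_archLocal L w (cw 0) (cw 2)⟩ : ↥(archLocal L 2 (Matrix.of fun i j : Fin 2 => if i.val + j.val + 1 = 2 then (1 : L) else 0) w)) TAL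
        (fun m hm => LineRing.forall_mem_torusU_comm (starRingEnd ℂ) _ (hypBlockGL_mem_torusU hJ (cw 0) (cw 2)) m hm) f := by
    funext y
    induction y using QuotientGroup.induction_on with
    | H g => rw [descConj_mk, descConj_mk, endoBlockAt_eq_mk_hypBlockGL L {w} hw1 cw]
  rw [hfun]
  -- ★ (A0-b) on the canonical quotient measure in Iwasawa form, for the GIVEN datum
  have hf' : Continuous (f : ↥(unitaryGroupOfForm (starRingEnd ℂ) ((Matrix.of fun i j : Fin 2 => if i.val + j.val + 1 = 2 then (1 : L) else 0).map w.1.embedding)) → ℂ) := hf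
  have key := abs_sub_smul_integral_descConj_hypBlockGL_eq_smul_integral_prod hJ κ' μN'
    (quotientMeasure (torusU (starRingEnd ℂ) ((Matrix.of fun i j : Fin 2 => if i.val + j.val + 1 = 2 then (1 : L) else 0).map w.1.embedding)) t hTc νw') hμC f hf' (cw 2) hcw
  rw [Complex.real_smul, Complex.real_smul] at key
  rw [mul_left_comm, Complex.ofReal_mul, mul_assoc]
  exact congrArg (fun z : ℂ => (D₀ : ℂ) * z) key

/-! ## §2 Vanishing transfers pointwise off the wall -/

include hN hB in
/-- **VANISHING OFF THE WALL TRANSFERS TO THE HALF-CHART.**  If the split reading `chartOrbHLoc L S w ν_w f cw` (`w ∈ S`, `cw 0 ≠ 0`) of a continuous `f` vanishes, so does the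
`K × N` half-chart integral at `(x, θ) = (cw 0, cw 2)` (§1: `D ≠ 0`). [cite: Varadarajan1989, §6.4 Thm 23] [cite: Rogawski1990, §8.2 p. 119] -/
theorem integral_halfChart_eq_zero_of_chartOrbHLoc_eq_zero
    (hK : IsCompact (K : Set ↥(archLocal L 2 (Matrix.of fun i j : Fin 2 => if i.val + j.val + 1 = 2 then (1 : L) else 0) w)))
    (hKB : ∀ g : ↥(archLocal L 2 (Matrix.of fun i j : Fin 2 => if i.val + j.val + 1 = 2 then (1 : L) else 0) w), ∃ k ∈ K, ∃ b ∈ B, g = k * b)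
    [iκ : IsHaarMeasure κ] [iμN : IsHaarMeasure μN]
    {f : ↥(archLocal L 2 (Matrix.of fun i j : Fin 2 => if i.val + j.val + 1 = 2 then (1 : L) else 0) w) → ℂ} (hf : Continuous f)
    {S : Finset {w : InfinitePlace L // IsComplex w}} (hw : w ∈ S) {cw : Fin 3 → ℝ} (hcw : cw 0 ≠ 0) (h0 : chartOrbHLoc L S w νw f cw = 0) :
    ∫ p : ↥K × ↥N,
      f ((p.1 : ↥(archLocal L 2 (Matrix.of fun i j : Fin 2 => if i.val + j.val + 1 = 2 then (1 : L) else 0) w)) *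
        ((⟨hypBlockGL 0 (cw 2), hypBlockGL_mem_archLocal L w 0 (cw 2)⟩ : ↥(archLocal L 2 (Matrix.of fun i j : Fin 2 => if i.val + j.val + 1 = 2 then (1 : L) else 0) w)) *
          (⟨hypBlockGL (cw 0 / 2) 0, hypBlockGL_mem_archLocal L w (cw 0 / 2) 0⟩ : ↥(archLocal L 2 (Matrix.of fun i j : Fin 2 => if i.val + j.val + 1 = 2 then (1 : L) else 0) w)) *
          (p.2 : ↥(archLocal L 2 (Matrix.of fun i j : Fin 2 => if i.val + j.val + 1 = 2 then (1 : L) else 0) w)) *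
          (⟨hypBlockGL (cw 0 / 2) 0, hypBlockGL_mem_archLocal L w (cw 0 / 2) 0⟩ : ↥(archLocal L 2 (Matrix.of fun i j : Fin 2 => if i.val + j.val + 1 = 2 then (1 : L) else 0) w))) *
        (p.1 : ↥(archLocal L 2 (Matrix.of fun i j : Fin 2 => if i.val + j.val + 1 = 2 then (1 : L) else 0) w))⁻¹) ∂(κ.prod μN) = 0 := by
  obtain ⟨D, hD, hall⟩ := exists_absExpSub_mul_chartOrbHLoc_eq_mul_integral_halfChart L w νw hN hB κ μN hK hKB
  have h := hall f hf S hw cw hcw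
  rw [h0, mul_zero] at h
  exact (mul_eq_zero.1 h.symm).resolve_left (Complex.ofReal_ne_zero.2 hD.ne')

/-! ## §3 (G1-w) ⇒ `Λ ≡ 0` near `0` and all jets of `Λ` at `0` vanish -/

include hN hB in
/-- **(N2) «`Λ_{f₀} ≡ 0` NEAR `0` FROM (G1-w)», JETS INCLUDED.**  `f : U(Φ₂)_w → ℂ` continuous with compact support; a label `S ∋ w`; a centre `θ` and `δ > 0` such that the split
readings on the ray through the wall point vanish: `chartOrbHLoc L S w ν_w f ![x, 0, θ] = 0` for `0 < |x| < δ` (the (G1-w) clause of ★ `exists_compactType_wallGenerator` at a centre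
`θ` with `dist (e^{iθ}) (e^{iθ₀}) < δ`; slot `1` is unread).  Then the `K × N` half-chart integral `Λ` of ★ (B-r1) at centre `θ` (token `hΛ`) vanishes for `|x| < δ` — off `0` by
§2, AT `0` by continuity (★ `continuous_integral_prod_conj_hypBlockGL_half`) — and ALL ITS JETS AT `0` VANISH: `∀ n, iteratedDeriv n Λ 0 = 0`.  With ★ (B-r1)
`exists_hasOneSidedJump_iteratedDeriv_allOrders_chart_of_eq_over` every jump `κ₀ · iⁿ · ∂ₓⁿΛ(0)` of the elliptic reading is therefore `0`.
[cite: Varadarajan1989, §6.4 Thm 23] [cite: Shelstad1979, Lemma 4.3 p. 25; Prop. 4.5 p. 26] [cite: Rogawski1990, §8.2 pp. 119–123] -/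
theorem halfChart_eq_zero_and_iteratedDeriv_eq_zero_of_chartOrbHLoc_eq_zero
    (hK : IsCompact (K : Set ↥(archLocal L 2 (Matrix.of fun i j : Fin 2 => if i.val + j.val + 1 = 2 then (1 : L) else 0) w)))
    (hKB : ∀ g : ↥(archLocal L 2 (Matrix.of fun i j : Fin 2 => if i.val + j.val + 1 = 2 then (1 : L) else 0) w), ∃ k ∈ K, ∃ b ∈ B, g = k * b)
    [iκ : IsHaarMeasure κ] [iμN : IsHaarMeasure μN]
    {f : ↥(archLocal L 2 (Matrix.of fun i j : Fin 2 => if i.val + j.val + 1 = 2 then (1 : L) else 0) w) → ℂ} (hf : Continuous f) (hfc : HasCompactSupport f)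
    {S : Finset {w : InfinitePlace L // IsComplex w}} (hw : w ∈ S) (θ : ℝ) {δ : ℝ} (hδ : 0 < δ)
    (hvan : ∀ x : ℝ, x ≠ 0 → |x| < δ → chartOrbHLoc L S w νw f ![x, 0, θ] = 0)
    (Λ : ℝ → ℂ)
    (hΛ : ∀ x : ℝ, Λ x = ∫ p : ↥K × ↥N,
      f ((p.1 : ↥(archLocal L 2 (Matrix.of fun i j : Fin 2 => if i.val + j.val + 1 = 2 then (1 : L) else 0) w)) *
        ((⟨hypBlockGL 0 θ, hypBlockGL_mem_archLocal L w 0 θ⟩ : ↥(archLocal L 2 (Matrix.of fun i j : Fin 2 => if i.val + j.val + 1 = 2 then (1 : L) else 0) w)) *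
          (⟨hypBlockGL (x / 2) 0, hypBlockGL_mem_archLocal L w (x / 2) 0⟩ : ↥(archLocal L 2 (Matrix.of fun i j : Fin 2 => if i.val + j.val + 1 = 2 then (1 : L) else 0) w)) *
          (p.2 : ↥(archLocal L 2 (Matrix.of fun i j : Fin 2 => if i.val + j.val + 1 = 2 then (1 : L) else 0) w)) *
          (⟨hypBlockGL (x / 2) 0, hypBlockGL_mem_archLocal L w (x / 2) 0⟩ : ↥(archLocal L 2 (Matrix.of fun i j : Fin 2 => if i.val + j.val + 1 = 2 then (1 : L) else 0) w))) *
        (p.1 : ↥(archLocal L 2 (Matrix.of fun i j : Fin 2 => if i.val + j.val + 1 = 2 then (1 : L) else 0) w))⁻¹) ∂(κ.prod μN)) :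
    (∀ x : ℝ, |x| < δ → Λ x = 0) ∧ ∀ n : ℕ, iteratedDeriv n Λ 0 = 0 := by
  -- off the wall: §2 on the ray `cw = ![x, 0, θ]`
  have hoff : ∀ x : ℝ, x ≠ 0 → |x| < δ → Λ x = 0 := fun x hx hxδ => by
    rw [hΛ]
    have h := integral_halfChart_eq_zero_of_chartOrbHLoc_eq_zero L w νw hN hB κ μN hK hKB hf hw (cw := ![x, 0, θ])
      (by simpa only [Matrix.cons_val_zero] using hx) (hvan x hx hxδ)
    simpa only [Matrix.cons_val_zero, Matrix.cons_val_two, Matrix.tail_cons, Matrix.head_cons] using h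
  -- at the wall: continuity of the half-chart integral (★ (A0) §3), read in the `unitaryGroupOfForm` spelling
  subst hN hB
  have hJ : ((Matrix.of fun i j : Fin 2 => if i.val + j.val + 1 = 2 then (1 : L) else 0).map w.1.embedding) = (StdForm.antidiagonal 2).over ℂ := by
    rw [Literature.NumberTheory.Rogawski1990.antidiagOne_map, StdForm.over_antidiagonal_eq]
  letI iG : MeasurableSpace ↥(unitaryGroupOfForm (starRingEnd ℂ) ((Matrix.of fun i j : Fin 2 => if i.val + j.val + 1 = 2 then (1 : L) else 0).map w.1.embedding)) := ‹MeasurableSpace ↥(archLocal L 2 (Matrix.of fun i j : Fin 2 => if i.val + j.val + 1 = 2 then (1 : L) else 0) w)›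
  haveI : BorelSpace ↥(unitaryGroupOfForm (starRingEnd ℂ) ((Matrix.of fun i j : Fin 2 => if i.val + j.val + 1 = 2 then (1 : L) else 0).map w.1.embedding)) := ‹BorelSpace ↥(archLocal L 2 (Matrix.of fun i j : Fin 2 => if i.val + j.val + 1 = 2 then (1 : L) else 0) w)›
  let K' : Subgroup ↥(unitaryGroupOfForm (starRingEnd ℂ) ((Matrix.of fun i j : Fin 2 => if i.val + j.val + 1 = 2 then (1 : L) else 0).map w.1.embedding)) := K
  let κ' : Measure ↥K' := κ
  haveI : IsHaarMeasure κ' := iκ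
  let μN' : Measure ↥(unipotentU (starRingEnd ℂ) ((Matrix.of fun i j : Fin 2 => if i.val + j.val + 1 = 2 then (1 : L) else 0).map w.1.embedding)) := μN
  haveI : IsHaarMeasure μN' := iμN
  have hK' : IsCompact (K' : Set ↥(unitaryGroupOfForm (starRingEnd ℂ) ((Matrix.of fun i j : Fin 2 => if i.val + j.val + 1 = 2 then (1 : L) else 0).map w.1.embedding))) := hK
  have hf' : Continuous (f : ↥(unitaryGroupOfForm (starRingEnd ℂ) ((Matrix.of fun i j : Fin 2 => if i.val + j.val + 1 = 2 then (1 : L) else 0).map w.1.embedding)) → ℂ) := hf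
  have hfc' : HasCompactSupport (f : ↥(unitaryGroupOfForm (starRingEnd ℂ) ((Matrix.of fun i j : Fin 2 => if i.val + j.val + 1 = 2 then (1 : L) else 0).map w.1.embedding)) → ℂ) := hfc
  have hcont' := continuous_integral_prod_conj_hypBlockGL_half hJ κ' μN' hK' f hf' hfc' θ
  have hΛeq : Λ = fun x : ℝ => ∫ p : ↥K' × ↥(unipotentU (starRingEnd ℂ) ((Matrix.of fun i j : Fin 2 => if i.val + j.val + 1 = 2 then (1 : L) else 0).map w.1.embedding)),
      f ((p.1 : ↥(unitaryGroupOfForm (starRingEnd ℂ) ((Matrix.of fun i j : Fin 2 => if i.val + j.val + 1 = 2 then (1 : L) else 0).map w.1.embedding))) *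
        ((⟨hypBlockGL 0 θ, hypBlockGL_mem_of_eq_over hJ 0 θ⟩ : ↥(unitaryGroupOfForm (starRingEnd ℂ) ((Matrix.of fun i j : Fin 2 => if i.val + j.val + 1 = 2 then (1 : L) else 0).map w.1.embedding))) *
          (⟨hypBlockGL (x / 2) 0, hypBlockGL_mem_of_eq_over hJ (x / 2) 0⟩ : ↥(unitaryGroupOfForm (starRingEnd ℂ) ((Matrix.of fun i j : Fin 2 => if i.val + j.val + 1 = 2 then (1 : L) else 0).map w.1.embedding))) *
          (p.2 : ↥(unitaryGroupOfForm (starRingEnd ℂ) ((Matrix.of fun i j : Fin 2 => if i.val + j.val + 1 = 2 then (1 : L) else 0).map w.1.embedding))) *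
          (⟨hypBlockGL (x / 2) 0, hypBlockGL_mem_of_eq_over hJ (x / 2) 0⟩ : ↥(unitaryGroupOfForm (starRingEnd ℂ) ((Matrix.of fun i j : Fin 2 => if i.val + j.val + 1 = 2 then (1 : L) else 0).map w.1.embedding)))) *
        (p.1 : ↥(unitaryGroupOfForm (starRingEnd ℂ) ((Matrix.of fun i j : Fin 2 => if i.val + j.val + 1 = 2 then (1 : L) else 0).map w.1.embedding)))⁻¹) ∂(κ'.prod μN') :=
    funext fun x => hΛ x
  have hcont : Continuous Λ := by rw [hΛeq]; exact hcont'
  -- `Λ 0 = 0`: the limit along the punctured neighbourhood of the eventually-zero function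
  have hev : ∀ᶠ x in 𝓝[≠] (0 : ℝ), Λ x = 0 := by
    have hball : ∀ᶠ x in 𝓝[≠] (0 : ℝ), |x| < δ := by
      have h : Metric.ball (0 : ℝ) δ ∈ 𝓝 (0 : ℝ) := Metric.ball_mem_nhds 0 hδ
      filter_upwards [mem_nhdsWithin_of_mem_nhds h] with x hx
      simpa only [Metric.mem_ball, dist_zero_right, Real.norm_eq_abs] using hx
    filter_upwards [hball, self_mem_nhdsWithin] with x hxδ hx
    exact hoff x hx hxδ
  have h0 : Λ 0 = 0 := by
    have h1 : Tendsto Λ (𝓝[≠] (0 : ℝ)) (𝓝 (Λ 0)) := (hcont.tendsto 0).mono_left nhdsWithin_le_nhds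
    have h2 : Tendsto Λ (𝓝[≠] (0 : ℝ)) (𝓝 0) := tendsto_const_nhds.congr' (hev.mono fun x hx => hx.symm)
    exact tendsto_nhds_unique h1 h2
  have hall : ∀ x : ℝ, |x| < δ → Λ x = 0 := fun x hxδ => by
    by_cases hx : x = 0
    · rw [hx]; exact h0
    · exact hoff x hx hxδ
  refine ⟨hall, fun n => ?_⟩
  -- jets: `Λ` agrees with `0` on the neighbourhood `(−δ, δ)` of `0`
  have hnhds : Λ =ᶠ[𝓝 (0 : ℝ)] (0 : ℝ → ℂ) := by
    filter_upwards [Metric.ball_mem_nhds (0 : ℝ) hδ] with x hx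
    exact hall x (by simpa only [Metric.mem_ball, dist_zero_right, Real.norm_eq_abs] using hx)
  rw [(hnhds.iteratedDeriv n).eq_of_nhds]
  exact iteratedDeriv_const_zero

end Docked

end Literature.NumberTheory.Rogawski1990

end
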